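import Mathlib
import HarnessLib
import HarnessLib.Audit
import Summits.Langlands.Statement
import Literature.NumberTheory.Automorphic.StrongArtinGL2

/-!
Route: EvenIcosahedralCM

CLOSED (retired) 2026-08-15T13:48:42Z by operator:999:1257524 — reason: not-a-thesis: assembly does not conclude the sub-problem Statement — note: D-0027 §2.1 audit (human 2026-08-15: routes that do not decide the summit are removed): the assembly concludes `EvenIcosahedralStrongArtin`, not the sub-problem statement; a NEW conforming route may be opened from the same idea (generated `closes : … → _root_.Langlands`).. The file is kept as the record of this route; refuted decls are indexed as negative knowledge (`ledger negatives`).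

# Route EvenIcosahedralCM — Langlands/Langlands (card even-icosahedral-p3-cm-corner)

## Thesis X (it suffices to show) — a SECTOR of conjunct (B) `GaloisToAutomorphic` (n = 2, F = ℚ,
Hodge–Tate weights (0,0))
Every EVEN irreducible σ : Γ_ℚ → GL_2(ℂ) of icosahedral type that is unramified at 3 with proj
σ(Frob_3) of
order 2 or 5 (the 3-distinguished sub-sector: eigenvalues distinct mod 3) is automorphic: there is a
cuspidal π on
GL_2(𝔸_ℚ) with π_v = π(σ_v) at almost all v (`IsPiOfArtinRep`, the tree's strong-Artin predicate of
`StrongArtinGL2`); decl `EvenIcosahedralStrongArtin` (= the Target item; Sketch.lean, lean check rc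
0).
Lean: `∀ σ : Literature.NumberTheory.GaloisRepresentations.FramedArtinRep ℚ 2,
σ.toGaloisRep.IsIrreducible → Literature.NumberTheory.GaloisRepresentations.IsIcosahedralType
σ.toMonoidHom → (∀ (φ : ℚ →+* ℝ) (c : Field.absoluteGaloisGroup ℚ),
Literature.NumberTheory.GaloisRepresentations.IsComplexConjugation φ c →
Matrix.GeneralLinearGroup.det (σ c) = 1) → (∀ v : IsDedekindDomain.HeightOneSpectrum
(NumberField.RingOfIntegers ℚ), (3 : NumberField.RingOfIntegers ℚ) ∈ v.asIdeal → σ.IsUnramifiedAt v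
∧ ∃ t d : ℂ, σ.HasFrobCharpolyAt v (Polynomial.X ^ 2 - Polynomial.C t * Polynomial.X + Polynomial.C
d) ∧ t ^ 2 ≠ d ∧ t ^ 2 ≠ 4 * d) → ∃ (hcpt :
Literature.NumberTheory.Automorphic.isCompact_glFiniteIntegralLevel 2 ℚ) (π :
Literature.NumberTheory.Automorphic.CuspidalAutomorphicRepData 2 ℚ hcpt),
Literature.NumberTheory.Automorphic.IsPiOfArtinRep σ π.1`
Like Parity/MinorArcs, the assembly ends in this sector statement, not in the summit constant
`Langlands`
(global reciprocity for all GL_n): no claim is made on the rest of the summit; the local–global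
clauses of
`Corresponds` at the finitely many remaining places follow for Artin-type π from Satake matching
(JL, Henniart) and
are deliberately not restated (same convention as `strongArtin_of_isSolvable`).

## Line of attack (card even-icosahedral-p3-cm-corner: the CM corner at the Klein prime p = 3)
Over an imaginary quadratic K there is no complex conjugation, so σ|_K looks like the base change of
a weight-one
form; p = 3 is the unique Klein prime where the icosahedral residual image is ENORMOUS (ad⁰ of A_5
mod 3 has
defect zero). Four typed steps, glued by pure logic (theorem `assembly_holds` in Sketch.lean):
  CMOrdinaryDoor → ArtinWeightOrdinaryLifting → UntwistAutomorphy → SolubleDescentMatching → X.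
(1) DOOR: over a soluble Galois CM field M (ζ_3 ∉ M) a twist τ = χ ⊗ σ|_M is residually (mod P | 3)
the
Galois representation of a weight-zero cuspidal π on GL_2(𝔸_M), ordinary at 3 (intended: Ellenberg's
level-3 Hilbert–Blumenthal door for GL_2(𝔽_9) transplanted to CM bases + AKT's p = 5 theorem over CM
fields).
(2) LIFTING at ARTIN weight: residual ordinary automorphy + 3-distinguished Artin τ ⇒ τ automorphic
over a
soluble Galois CM M' ⊇ M. Its p-adic half (occurrence of τ in ordinary completed cohomology at the
weight-one
point κ₁) is the card's claimed-new step and is near ACC+ §6.6; its archimedean half (classicality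
at weight
one over CM) is THE WALL, declared not claimed.
(3) UNTWIST (support) and (4) SOLUBLE DESCENT WITH GALOIS MATCHING from M' to ℚ — a crux this
planner adds to
the card: without Galois representations for Artin-type forms on intermediate CM fields, matching a
cyclic
descent with σ is not automatic (Langlands–Tunnell needed Gelbart–Jacquet resp. Tunnell's cubic
trick).

Rationale: WHY THIS LINE. p-adic automorphy lifting in positive defect (Calegari–Geraghty; ACC+ =
ACCGHLNSTT2023 Thm 6.1.2,
§6.6; KhareThorne2017 Thm 6.30) imported to the one place where an EVEN icosahedral σ has (a) no
parity
obstruction (CM base: det = ε̄_3 allowed), (b) ENORMOUS residual image (p = 3, defect zero: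
DefectZeroA5),
(c) weight-independent numerology (Hida ordinary deformation theory: Euler characteristic [M:ℚ] −
3·[M:ℚ]/2 =
−l₀ at every weight, incl. the Artin weight κ₁). Reading ACC+ §6.6 (arXiv:1812.09999 Thm 125, Prop
81,
Prop 100, Cor 101, Rem 73 "what we in fact prove is that ρ contributes to the ordinary part of
completed
cohomology") shows the p-adic half of the lifting crux is weight-blind except ONE local statement
(the Artin
point, where two refinements cross, must lie on a max-dimensional component of Spec R_v^{det,ord};
it lies in
g⁻¹(Z)). CalegariMazur2008 Thm 8.1 (arXiv:0708.2451 §8.2) is consistent: the Hida family through the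
weight-one
point moves in the anti-diagonal weight direction; no classical point is needed or claimed.
RANKED CRUXES. r2 ArtinWeightOrdinaryLifting (engine C1 + wall C5; most informative: decides whether
the
theorem-sized deliverable "σ|_M is 3-adically ordinary-automorphic of weight one" exists; the wall
is open).
r3 CMOrdinaryDoor (Ellenberg2005 Prop 1.3 over CM bases + ShepherdBarronTaylor1997 +
AllenKhareThorne2021WeightOne
Thm 9.16 + 5-adic lifting; new thin condition: CM-ness of the quartic field of the HBAV point; sign
bookkeeping
ε̄_3(c_p)ω_K(c_p) = det σ(c_p) fixes the admissible K).
r4 SolubleDescentMatching (added by this planner: matching cyclic descents with σ without Galois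
reps
downstairs; rescues: two-quadratic-subfield central characters, parity at the bottom layer via
Deligne–Serre/Rogawski–Tunnell, Ramakrishnan2000 SL(2) multiplicity one + varying K; CM/CM quadratic
layers open).
Support: UntwistAutomorphy (CFT twist, provable now), DefectZeroA5 (finite group cohomology,
provable now),
Assembly (pure logic, proved in Sketch.lean as `assembly_holds`), Target.
KILL CRITERIA. (i) a counterexample to the max-dim-component statement at Artin points of
R_v^{det,ord}
(kills C1 as an ACC+ corollary, not the route); (ii) a proof that the twisted level-3 HMS has no
CM-valued
soluble points with ordinary reduction at 3 for some admissible σ (kills the door at p = 3; only p =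
2 doors
remain → close); (iii) an even icosahedral σ whose L(s,σ) has a pole (refutes X itself; Booker2003
frame);
(iv) SolubleDescentMatching shown to REQUIRE Galois reps for Artin-type forms (then it merges into
the wall).
NOT DECOMPOSED YET. The two halves C1/C5 of the lifting crux (children once
`OrdinaryCompletedCohomology`
lands: definition request filed); the door's geometry (HBAV notions: definition request filed);
which rescue
closes SolubleDescentMatching; a potentially-diagonalizable variant for proj σ(Frob_3) of order 1 or
3;
local–global compatibility at ramified places (Henniart) between X and `Corresponds`.
CHEAPEST FALSIFIER. Two lookups, cheapest first: (1) the local-ring statement inside crux r2 —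
decide from ACC+ Prop 81 (arXiv:1812.09999 §6.2) whether a direct sum of two distinct unramified
characters at trivial inertial weight lies on the component of Spec R_v^{det,ord} dominating Spec
Λ_v (if NOT, the p-adic half of r2 is no longer an ACC+ corollary and r2 loses its 'attackable
half'); (2) the door's CM-ness constraint — for ONE explicit even A_5 field (Doud–Moore tables) and
K = ℚ(√−6) write the sign conditions ε̄_3(c_p)ω_K(c_p) = det σ(c_p) and check that the twisted
level-3 HMS descends to ℚ; a failure for every admissible K kills CMOrdinaryDoor at p = 3. Neither
could be run in this session (no kit job needed for (1); (2) is a pen-and-paper check a refuter can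
do from Ellenberg2005 §2.1).

Novelty: NOVELTY (D-0021; searches run 2026-08-15: `lit read` at the page of arXiv:0708.2451 §8.2
(Calegari–Mazur Thm 8.1), arXiv:1409.7007 (Khare–Thorne Thm 6.30, Conj 6.18/6.28, §4 'totally odd …
If F is totally complex this condition is empty'), arXiv:1812.09999 (ACC+ Thm 6.1.2 + Rem 73, §6.6
Thm 125, Prop 79/81, Prop 100, Cor 101), arXiv:1910.12986 (AKT §1 'one does not know how to go from
weight 1 to weight 2', Thm 9.16), arXiv:math/0107147 (Ellenberg Prop 1.3, §2); `lit frontier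
Langlands --since 2020` (30 rows; relevant: arXiv:2605.03519 infinitesimal characters of completed
cohomology of GL_n over CM fields, arXiv:2604.05618 base-change lifts of Hida families), `lit
bridges Langlands --cross any`; `lit search` via crossref/zbmath for "strong Artin even icosahedral"
(Booker2003, Cho–Kim), "weight one Bianchi Artin p-adic" (Williams 2017, Barrera–Williams 2021:
p-adic L-functions, not automorphy), "Hilbert–Blumenthal CM field modularity F9" (nothing), and the
ledger's own cards (even-artin-gl4-door p = 2 over ℚ; klein-closes-the-loop superseded into this
card); local searchd / OpenAlex / S2 / arXiv API / galaxy were rate-limited or unavailable during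
this session (logged; the card's refuter audit of 2026-08-15 had already searched
OpenAlex/zbMATH/arXiv).
NEAREST PRIOR ART. (1) CalegariMazur2008 §8.2, Thm 8.1: the frame "even Artin ρ over an imaginary
quadratic K in nearly ordinary families"; a NEGATIVE first step (no Gal(K/ℚ)-compatible classical
nearly ordinary family) — consis  [refs: 0708.2451, 1409.7007, 1812.09999, 1910.12986, math/0107147, 2605.03519, 2604.05618, Booker2003, CalegariMazur2008, KhareThorne2017, ACCGHLNSTT2023, Ellenberg2005, AllenKhareThorne2021, HansenUniversalEigenvarieties2017, LanglandsBaseChange1980, Tunnell1981, Ramakrishnan2000]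

Barriers (technique_class: automorphy-lifting completed-cohomology solvable-descent): - technique_class: automorphy-lifting completed-cohomology solvable-descent
- Literature.Barriers.Langlands.TaylorWilesNumericalCoincidence: APPLIES (GL_2 over a CM field has
l₀ = [M:ℚ]/2 > 0, `defectGL_eq_zero_iff`). Evaded exactly as catalogued in evasions_known
(ii)–(iii): Calegari–Geraghty / Khare–Thorne / ACC+ patching of COMPLEXES over l₀ + 1 degrees; the
only novelty is the weight (Artin weight κ₁) at which the Λ-adic ordinary complex is specialised,
and Hida theory makes the count weight-independent ([M:ℚ]·1 − 3·[M:ℚ]/2 = −l₀).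
- Literature.Barriers.Langlands.TaylorWilesNumericalCoincidenceNarrow: APPLIES (case β: n = 2 over
CM, τ not a base change from M⁺ up to twist in general, no totally odd polarisation). Same evasion
(positive defect); scope caveat (b) "irregular weight lowers the p-adic term" is answered by using
the Hida-ordinary local condition (dim L_v − h⁰ = [M_v:ℚ_3] at every weight) instead of the de Rham
weight-(0,0) condition (which would give −3l₀).
- Literature.Barriers.Langlands.NonRegularWeightBarrier: MET HEAD-ON and SPLIT (the point of the
card): the p-adic half — τ occurs in ORDINARY COMPLETED cohomology specialised at κ₁ (not in H*(X,
V_λ) for any dominant λ; the barrier's `cohomologicalInfinityType` class is not used at the Artin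
weight) — is crux r2's attackable half (ACC+ Rem 73 / Cor 101 are weight-blind); the archimedean
half (classicality of the weight-one eigensystem: scope_caveat "absence of a KNOWN p-adic theory",
evasions_known list onl

History (route lifecycle, newest last):
- 2026-08-15T13:48:42Z · CLOSED retired — not-a-thesis: assembly does not conclude the sub-problem Statement (operator:999:1257524)

sub-problem: Langlands · status: closed(retired) · opened planner-plancard-Langlands-Langlands-even-ico-c7566e0e-0 2026-08-15T11:18:42Z · rev 2 · ledger route-Langlands-EvenIcosahedralCM
GENERATED by the gate from the ledger (D-0016/17). Provers cite these decls: `theorem foo : Summit.Langlands.Langlands.Theses.EvenIcosahedralCM.<Decl> := …` in Summits/Langlands/Langlands/Theorems/<Name>.lean.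
-/

namespace Summit.Langlands.Langlands.Theses.EvenIcosahedralCM

open scoped BigOperators Topology Manifold Classical MeasureTheory ProbabilityTheory Matrix InnerProductSpace ComplexConjugate ContinuousMap
open Filter Set Function TopologicalSpace MeasureTheory

attribute [summit_statement] _root_.Langlands

/-- item stmt-Langlands-3478 · target · rank 0 · closed · moot by None · by planner
why it might fail: Wide open: 'we cannot establish the Artin conjecture for a single even A5 representation' (Calegari ICM 2022 §12) — eigenvalue-1/4 Maass forms are seen by no Shimura variety/cohomology; every engine here crosses wt-1 classicality over CM (r2). Refutable only by an even σ with non-entire L(s,σ⊗χ).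
sources: Calegari2023, §12 (arXiv:2109.14145 p. 28, read: 'The depths of our ignorance'), BuzzardEtAl2001, Introduction, KhareWintenberger2009 (odd case is a theorem), Booker2003, Thm 1 (poles of Artin L-functions vs strong Artin)
[target] X = strong Artin (a cuspidal pi on GL_2(A_Q) with pi_v = pi(sigma_v) a.e., tree predicate
`IsPiOfArtinRep` of StrongArtinGL2) for every EVEN irreducible sigma : Gamma_Q -> GL_2(C) of
icosahedral type, unramified at 3 with proj sigma(Frob_3) of order 2 or 5 (charpoly X^2 - tX + d
with t^2 != d, t^2 != 4d <=> eigenvalues distinct mod 3: the 3-distinguished sub-sector, of positive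
density among even A_5 fields). Instance-family of conjunct (B) `GaloisToAutomorphic` for n = 2, F =
Q, HT weights (0,0) (geometric automatic for finite image); local-global clauses at the finitely
many ramified places follow for Artin-type pi from Satake matching (JL, Henniart) and are not
restated (convention of `strongArtin_of_isSolvable`). Odd icosahedral sigma: theorem
(Khare-Wintenberger); even: open (Calegari ICM 2022 §12). Sources: Calegari2023 §12;
BuzzardEtAl2001; KhareWintenberger2009; Booker2003. -/
@[route_item "route-Langlands-EvenIcosahedralCM"]
def EvenIcosahedralStrongArtin : Prop :=
  ∀ σ : Literature.NumberTheory.GaloisRepresentations.FramedArtinRep ℚ 2, σ.toGaloisRep.IsIrreducible → Literature.NumberTheory.GaloisRepresentations.IsIcosahedralType σ.toMonoidHom → (∀ (φ : ℚ →+* ℝ) (c : Field.absoluteGaloisGroup ℚ), Literature.NumberTheory.GaloisRepresentations.IsComplexConjugation φ c → Matrix.GeneralLinearGroup.det (σ c) = 1) → (∀ v : IsDedekindDomain.HeightOneSpectrum (NumberField.RingOfIntegers ℚ), (3 : NumberField.RingOfIntegers ℚ) ∈ v.asIdeal → σ.IsUnramifiedAt v ∧ ∃ t d : ℂ, σ.HasFrobCharpolyAt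 v (Polynomial.X ^ 2 - Polynomial.C t * Polynomial.X + Polynomial.C d) ∧ t ^ 2 ≠ d ∧ t ^ 2 ≠ 4 * d) → ∃ (hcpt : Literature.NumberTheory.Automorphic.isCompact_glFiniteIntegralLevel 2 ℚ) (π : Literature.NumberTheory.Automorphic.CuspidalAutomorphicRepData 2 ℚ hcpt), Literature.NumberTheory.Automorphic.IsPiOfArtinRep σ π.1

/-- item stmt-Langlands-3479 · crux · rank 2 · closed · moot by None · by planner
why it might fail: FALSE AS TYPED: M any CM field, yet M'⊇M must be solvable Galois/ℚ (Sketch isSolvable_of_algebra); hyps hold over M=F·ℚ(√−6), F totally real A5-Galois (odd ico σ0: KW wt-1 form→wt-2 3-ord. lift, χ₋₃ nebentypus→Dieulefait BC). Fix: add IsGalois ℚ M ∧ IsSolvable. Real wall: wt-1 classicality over CM.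
sources: ACCGHLNSTT2023, Thm 6.1.2 + Rem 6.1.3 (arXiv:1812.09999 read: ordinary lifting needs REGULAR Hodge–Tate weights; 'what we in fact prove is that ρ contributes to the ordinary part of completed cohomology'), KhareThorne2017, Thm 6.30 (arXiv:1409.7007 p.36 read: conditional big ordinary R=T; fixed-weight clause needs regular dominant λ), CalegariMazur2008, Thm 8.1 (arXiv:0708.2451 §8.2 read: even Artin ρ|K admits no classical nearly ordinary family, under Leopoldt), AllenKhareThorne2021WeightOne, §1 (arXiv:1910.12986 p.4 read: 'one does not know how to go from weight 1 to weight 2' over CM fields), Dieulefait2012, Thm 1.1 (arXiv:0912.2080 read: BC of odd-level weight ≥ 2 newforms to totally real Galois F with 2,3,7,11 split) — realises the typed hypotheses over a CM field with non-solvable Galois group, KhareWintenberger2009 (odd icosahedral σ0 modular of weight one)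
[crux] ARTIN-WEIGHT ORDINARY (POTENTIAL) AUTOMORPHY OVER CM FIELDS AT p = 3. M imaginary CM with
zeta_3 not in M; tau : Gamma_M -> GL_2(C) of icosahedral type, unramified and 3-distinguished at
every w | 3 (so ordinary of Artin weight kappa_1 for either refinement); RESIDUAL ORDINARY
AUTOMORPHY: a weight-zero cuspidal pi on GL_2(A_M), unramified and iota-ordinary at w | 3 (a 3-adic
unit root of the Hecke polynomial), whose Hecke eigenvalues a_w = sqrt(q_w)*sum(alpha) are congruent
mod ONE prime P | 3 of Zbar to tr tau(Frob_w) for a.e. w (<=> tau-bar = r-bar_iota(pi)^ss up to the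
Frobenius-normalisation twist; lang.S28 convention), and a decomposed-generic prime l (explicit).
CONCLUSION: tau becomes automorphic (IsPiOfArtinRep) over some soluble, Galois-over-Q CM extension
M'/M (potential form: all matching-descent difficulty is moved to SolubleDescentMatching). TWO
HALVES (the card's split of NonRegularWeightBarrier; to become the children of this node once Lean
has ordinary completed cohomology, definition request filed): (C1, p-adic half, claimed attackable)
tau|_{M'} occurs in Hida's ordinary completed cohomology H*_ord(U)_m (x)_Lambda kappa_1 at the ARTIN
weight: run ACC+ §6.6 -/
@[route_item "route-Langlands-EvenIcosahedralCM"]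
def ArtinWeightOrdinaryLifting : Prop :=
  ∀ (M : Type) [Field M] [NumberField M], NumberField.IsCMField M → (∀ z : M, z ^ 2 + z + 1 ≠ 0) → ∀ τ : Literature.NumberTheory.GaloisRepresentations.FramedArtinRep M 2, (Literature.NumberTheory.GaloisRepresentations.IsIcosahedralType τ.toMonoidHom ∧ (∀ w : IsDedekindDomain.HeightOneSpectrum (NumberField.RingOfIntegers M), (3 : NumberField.RingOfIntegers M) ∈ w.asIdeal → τ.IsUnramifiedAt w ∧ ∃ t d : ℂ, τ.HasFrobCharpolyAt w (Polynomial.X ^ 2 - Polynomial.C t * Polynomial.X + Polynomial.C d) ∧ t ^ 2 ≠ d ∧ t ^ 2 ≠ 4 * d) ∧ ∃ (hM : Literature.NumberTheory.Automorphic.isCompact_glFiniteIntegralLevel 2 M) (π : Literature.NumberTheory.Automorphic.CuspidalAutomorphicRepData 2 M hM) (P : Ideal (integralClosure ℤ ℂ)), π.1.HasWeightZero ∧ P.IsMaximal ∧ (3 : integralClosure ℤ ℂ) ∈ P ∧ (∀ w : IsDedekindDomain.HeightOneSpectrum (NumberField.RingOfIntegers M), (3 : NumberField.RingOfIntegers M)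 ∈ w.asIdeal → ∃ α : Multiset ℂ, π.1.HasSatakeParamAt w α ∧ ∃ a ∈ α, ∃ u : integralClosure ℤ ℂ, (u : ℂ) = Real.sqrt w.residueCard * a ∧ u ∉ P) ∧ (∀ᶠ w : IsDedekindDomain.HeightOneSpectrum (NumberField.RingOfIntegers M) in Filter.cofinite, ∃ α : Multiset ℂ, π.1.HasSatakeParamAt w α ∧ ∃ a b : integralClosure ℤ ℂ, (a : ℂ) = Real.sqrt w.residueCard * α.sum ∧ (b : ℂ) = τ.toGaloisRep.frobTrace w ∧ a - b ∈ P) ∧ (∃ l : ℕ, l.Prime ∧ l ≠ 3 ∧ ¬ ((l : ℤ) ∣ NumberField.discr M) ∧ ∀ w : IsDedekindDomain.HeightOneSpectrum (NumberField.RingOfIntegers M), (l : NumberField.RingOfIntegers M) ∈ w.asIdeal → w.residueCard = l ∧ τ.IsUnramifiedAt w ∧ ∃ t d : ℂ, τ.HasFrobCharpolyAt w (Polynomial.X ^ 2 - Polynomial.C t * Polynomial.X + Polynomial.C d) ∧ ∃ a b : integralClosure ℤ ℂ, (a : ℂ) = t ∧ (b : ℂ) = d ∧ a ^ 2 - 4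 * b ∉ P ∧ b * ((l : integralClosure ℤ ℂ) + 1) ^ 2 - (l : integralClosure ℤ ℂ) * a ^ 2 ∉ P)) → ∃ (M' : Type) (_ : Field M') (_ : NumberField M') (_ : Algebra M M'), NumberField.IsCMField M' ∧ IsGalois ℚ M' ∧ IsSolvable (M' ≃ₐ[ℚ] M') ∧ ∃ (hM' : Literature.NumberTheory.Automorphic.isCompact_glFiniteIntegralLevel 2 M') (π' : Literature.NumberTheory.Automorphic.CuspidalAutomorphicRepData 2 M' hM'), Literature.NumberTheory.Automorphic.IsPiOfArtinRep (τ.restrictField M') π'.1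

/-- item stmt-Langlands-3480 · crux · rank 3 · closed · moot by None · by planner
why it might fail: Ellenberg2005 Prop 1.3/§2 is totally-real-only: HMS points come by weak approximation, but the field must be CM and Galois-solvable/ℚ — global/thin, not forced locally (Moret-Bailly); τ unram.+det τ̄=ε̄₃ force e(w|3) even, voiding Prop 1.2; at p=5 AKT 8.1/9.16 need Tate shape at w|3, ζ5∉proj field.
sources: Ellenberg2005, Prop 1.2, Prop 1.3, §2 (arXiv:math/0107147 p.5 read: K totally real, odd ramification at 3 and 5, F/K solvable totally real), AllenKhareThorne2021WeightOne, Thm 8.1 and Thm 9.16 (arXiv:1910.12986 pp.56,63 read: 5-adic ordinary lifting over CM with projective image PSL2(F5) needs ζ5 ∉ proj field since H1(SL2(F5),ad0)≠0; mod-5 residual modularity needs Tate-curve shape at v|3), ShepherdBarronTaylor1997, Thm 1.2, AllenKhareThorne2021, Thm 1.1 (PNAS 118: |k|=9 over totally real fields), ACCGHLNSTT2023, Thm 6.1.2, Taylor2006, Thm A (Moret-Bailly template: local conditions only)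
[crux] THE CM DOOR (residual ordinary automorphy over a soluble CM field). For sigma as in the
target: a soluble Galois CM field M/Q with zeta_3 not in M, a finite-order character chi of Gamma_M
and tau = chi (x) sigma|_M such that tau is of icosahedral type, 3-distinguished at w | 3,
decomposed generic, and residually (mod P | 3) equal to r-bar(pi) for a weight-zero cuspidal pi on
GL_2(A_M) unramified-ordinary at w | 3 (the clause is VERBATIM the hypothesis block of
ArtinWeightOrdinaryLifting, so the assembly is pure logic). INTENDED CONSTRUCTION (Ellenberg 2005
Prop 1.3 transplanted from totally real to CM bases, where the parity obstruction to det = eps-bar_3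
disappears): K imaginary quadratic chosen so that sigma-bar_3 (x) chi-bar has cyclotomic determinant
with chi-bar from Q (sign bookkeeping eps-bar_3(c_p) omega_K(c_p) = det sigma(c_p) for all p;
consistent exactly because K is imaginary and sigma even; det sigma = 1 forces 3 | d_K with K_3 not
containing zeta_3, e.g. K = Q(sqrt -6), Q(sqrt(-3q)) with q = 1 mod 4); the twisted level-3 Hilbert
modular surface of Q(sqrt 5) (van der Geer: sigma_1 = sigma_2 = sigma_4 = 0 in P^5, A_6 =
PSL_2(F_9)) descends to Q and has points ove -/
@[route_item "route-Langlands-EvenIcosahedralCM"]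
def CMOrdinaryDoor : Prop :=
  ∀ σ : Literature.NumberTheory.GaloisRepresentations.FramedArtinRep ℚ 2, σ.toGaloisRep.IsIrreducible → Literature.NumberTheory.GaloisRepresentations.IsIcosahedralType σ.toMonoidHom → (∀ (φ : ℚ →+* ℝ) (c : Field.absoluteGaloisGroup ℚ), Literature.NumberTheory.GaloisRepresentations.IsComplexConjugation φ c → Matrix.GeneralLinearGroup.det (σ c) = 1) → (∀ v : IsDedekindDomain.HeightOneSpectrum (NumberField.RingOfIntegers ℚ), (3 : NumberField.RingOfIntegers ℚ) ∈ v.asIdeal → σ.IsUnramifiedAt v ∧ ∃ t d : ℂ, σ.HasFrobCharpolyAt v (Polynomial.X ^ 2 - Polynomial.C t * Polynomial.X + Polynomial.C d) ∧ t ^ 2 ≠ d ∧ t ^ 2 ≠ 4 * d) → ∃ (M : Type) (_ : Field M) (_ : NumberField M), NumberField.IsCMField M ∧ IsGalois ℚ M ∧ IsSolvable (M ≃ₐ[ℚ] M) ∧ (∀ z : M, z ^ 2 + z + 1 ≠ 0) ∧ ∃ (χ : Literature.NumberTheory.GaloisRepresentations.FramedArtinRep M 1) (τ : Literature.NumberTheory.GaloisRepresentations.FramedArtinRep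 M 2), (∀ g : Field.absoluteGaloisGroup M, ((τ g : Matrix.GeneralLinearGroup (Fin 2) ℂ) : Matrix (Fin 2) (Fin 2) ℂ) = ((Matrix.GeneralLinearGroup.det (χ g) : ℂˣ) : ℂ) • ((σ.restrictField M g : Matrix.GeneralLinearGroup (Fin 2) ℂ) : Matrix (Fin 2) (Fin 2) ℂ)) ∧ (Literature.NumberTheory.GaloisRepresentations.IsIcosahedralType τ.toMonoidHom ∧ (∀ w : IsDedekindDomain.HeightOneSpectrum (NumberField.RingOfIntegers M), (3 : NumberField.RingOfIntegers M) ∈ w.asIdeal → τ.IsUnramifiedAt w ∧ ∃ t d : ℂ, τ.HasFrobCharpolyAt w (Polynomial.X ^ 2 - Polynomial.C t * Polynomial.X + Polynomial.C d) ∧ t ^ 2 ≠ d ∧ t ^ 2 ≠ 4 * d) ∧ ∃ (hM : Literature.NumberTheory.Automorphic.isCompact_glFiniteIntegralLevel 2 M) (π : Literature.NumberTheory.Automorphic.CuspidalAutomorphicRepData 2 M hM) (P : Ideal (integralClosure ℤ ℂ)), π.1.HasWeightZero ∧ P.IsMaximal ∧ (3 : integralClosure ℤ ℂ) ∈ P ∧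 (∀ w : IsDedekindDomain.HeightOneSpectrum (NumberField.RingOfIntegers M), (3 : NumberField.RingOfIntegers M) ∈ w.asIdeal → ∃ α : Multiset ℂ, π.1.HasSatakeParamAt w α ∧ ∃ a ∈ α, ∃ u : integralClosure ℤ ℂ, (u : ℂ) = Real.sqrt w.residueCard * a ∧ u ∉ P) ∧ (∀ᶠ w : IsDedekindDomain.HeightOneSpectrum (NumberField.RingOfIntegers M) in Filter.cofinite, ∃ α : Multiset ℂ, π.1.HasSatakeParamAt w α ∧ ∃ a b : integralClosure ℤ ℂ, (a : ℂ) = Real.sqrt w.residueCard * α.sum ∧ (b : ℂ) = τ.toGaloisRep.frobTrace w ∧ a - b ∈ P) ∧ (∃ l : ℕ, l.Prime ∧ l ≠ 3 ∧ ¬ ((l : ℤ) ∣ NumberField.discr M) ∧ ∀ w : IsDedekindDomain.HeightOneSpectrum (NumberField.RingOfIntegers M), (l : NumberField.RingOfIntegers M) ∈ w.asIdeal → w.residueCard = l ∧ τ.IsUnramifiedAt w ∧ ∃ t d : ℂ, τ.HasFrobCharpolyAt w (Polynomial.X ^ 2 - Polynomial.C t * Polynomial.X + Polynomial.C d) ∧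 ∃ a b : integralClosure ℤ ℂ, (a : ℂ) = t ∧ (b : ℂ) = d ∧ a ^ 2 - 4 * b ∉ P ∧ b * ((l : integralClosure ℤ ℂ) + 1) ^ 2 - (l : integralClosure ℤ ℂ) * a ^ 2 ∉ P))

/-- item stmt-Langlands-3481 · crux · rank 4 · closed · moot by None · by planner
why it might fail: Implied by strong Artin (only ¬X refutes it); OPEN as a step: cyclic descents exist (AC Ch.3 Thm 4.2) but matching one with σ needs Galois reps for Artin-type π on CM layers; at inert v of an odd layer t_v~σ(Frob_v)diag(ζ^i,ζ^-i), i≠0, untwistable; the L–T Ad-trick needs Ad σ automorphic (open).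
sources: LanglandsBaseChange1980, §3 (tetrahedral case: the right cubic descent is pinned down with the Gelbart–Jacquet Ad lift), Tunnell1981 (octahedral case via cubic non-normal base change), ArthurClozelAMS120, Ch. 3 Thm 4.2 (fibres of prime-degree cyclic base change are the twists π⊗η^j), Ramakrishnan2000, Thm 4.1.2 (multiplicity one for SL(2): partial rescue), Rajan1999, Calegari2023, §12 (arXiv:2109.14145 p.28: no handle on Maass forms for even A5)
[crux] SOLUBLE DESCENT WITH GALOIS MATCHING FOR EVEN ARTIN TYPE. sigma even icosahedral over Q
(3-distinguished hypothesis carried, unused); M'/Q soluble Galois CM; M an arbitrary intermediate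
field ((sigma|_M)|_{M'} is conjugate to sigma|_{M'}, since absGaloisRestrict composes up to an inner
automorphism, so this is descent of automorphy from M' to Q): if sigma|_{M'} is automorphic (a
cuspidal pi' with pi' = pi(sigma|_{M'}) a.e.) then sigma is automorphic over Q. EXISTENCE of
descents layer by layer is known (Arthur-Clozel Ch. 3 Thm 4.2(d): a Galois-stable cuspidal Pi on a
cyclic layer E/F of prime degree descends to l twists pi (x) eta^j; tree facts
`cuspidal_descent_cyclic`, `ArthurClozel1989_fibres_of_baseChange`); the CONTENT is MATCHING one
descent with sigma|_F: Artin-type (weight-one) forms on intermediate CM or mixed fields carry no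
Galois representations, so the standard Chebotarev matching of soluble descent (BLGGT-style) is
unavailable, and at inert places t_{pi,v}^l ~ sigma(Frob_v)^l leaves a root-of-unity ambiguity that
can be NON-SCALAR (t ~ sigma(Frob_v) diag(zeta^a, zeta^b), a != b), not removable by twisting (this
is why Langlands-Tunnell needed Gelbart-Jacquet re -/
@[route_item "route-Langlands-EvenIcosahedralCM"]
def SolubleDescentMatching : Prop :=
  ∀ σ : Literature.NumberTheory.GaloisRepresentations.FramedArtinRep ℚ 2, σ.toGaloisRep.IsIrreducible → Literature.NumberTheory.GaloisRepresentations.IsIcosahedralType σ.toMonoidHom → (∀ (φ : ℚ →+* ℝ) (c : Field.absoluteGaloisGroup ℚ), Literature.NumberTheory.GaloisRepresentations.IsComplexConjugation φ c → Matrix.GeneralLinearGroup.det (σ c) = 1) → (∀ v : IsDedekindDomain.HeightOneSpectrum (NumberField.RingOfIntegers ℚ), (3 : NumberField.RingOfIntegers ℚ) ∈ v.asIdeal → σ.IsUnramifiedAt v ∧ ∃ t d : ℂ, σ.HasFrobCharpolyAt v (Polynomial.X ^ 2 - Polynomial.C t * Polynomial.X + Polynomial.C d) ∧ t ^ 2 ≠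 d ∧ t ^ 2 ≠ 4 * d) → ∀ (M : Type) [Field M] [NumberField M] (M' : Type) [Field M'] [NumberField M'] [Algebra M M'], NumberField.IsCMField M' → IsGalois ℚ M' → IsSolvable (M' ≃ₐ[ℚ] M') → (∃ (hM' : Literature.NumberTheory.Automorphic.isCompact_glFiniteIntegralLevel 2 M') (π' : Literature.NumberTheory.Automorphic.CuspidalAutomorphicRepData 2 M' hM'), Literature.NumberTheory.Automorphic.IsPiOfArtinRep ((σ.restrictField M).restrictField M') π'.1) → ∃ (hcpt : Literature.NumberTheory.Automorphic.isCompact_glFiniteIntegralLevel 2 ℚ) (π : Literature.NumberTheory.Automorphic.CuspidalAutomorphicRepData 2 ℚ hcpt), Literature.NumberTheory.Automorphic.IsPiOfArtinRep σ π.1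

/-- item stmt-Langlands-3482 · support · rank 9 · closed · moot by None · by planner
sources: ArthurClozelAMS120, Ch. 3 proof of Thm 3.1, CasselsFrohlichANT1967, Ch. VII §5.1, Literature.NumberTheory.Automorphic.exists_twist_quadraticSign_of_reciprocity
[support] UNTWISTING. If tau = chi (x) sigma' pointwise (chi a rank-one Artin representation =
finite-order character, as det of GL_1-values) and tau = pi(tau) a.e. for a cuspidal pi on
GL_2(A_M), then sigma' = pi(sigma') a.e. with pi(sigma') := pi (x) (omega_chi^{-1} o det), omega_chi
the finite-order Hecke character of chi: Artin reciprocity for characters is PROVED in the tree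
(`artinReciprocity_character_holds`), the twist API exists (`CuspidalAutomorphicRepData.twist`,
`AutomorphicRepData.HasSatakeParamAt.twist`: t_{pi (x) omega, v} = omega(varpi_v) t_{pi,v}); mirror
`exists_twist_quadraticSign_of_reciprocity` (LanglandsTunnellTwist). Routine glue; provable now.
Sources: ArthurClozelAMS120 Ch. 3 proof of Thm 3.1; CasselsFrohlichANT1967 Ch. VII §5; tree decl
Literature.NumberTheory.Automorphic.exists_twist_quadraticSign_of_reciprocity. -/
@[route_item "route-Langlands-EvenIcosahedralCM"]
def UntwistAutomorphy : Prop :=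
  ∀ (M : Type) [Field M] [NumberField M] (σ' τ : Literature.NumberTheory.GaloisRepresentations.FramedArtinRep M 2) (χ : Literature.NumberTheory.GaloisRepresentations.FramedArtinRep M 1), (∀ g : Field.absoluteGaloisGroup M, ((τ g : Matrix.GeneralLinearGroup (Fin 2) ℂ) : Matrix (Fin 2) (Fin 2) ℂ) = ((Matrix.GeneralLinearGroup.det (χ g) : ℂˣ) : ℂ) • ((σ' g : Matrix.GeneralLinearGroup (Fin 2) ℂ) : Matrix (Fin 2) (Fin 2) ℂ)) → (∃ (hM : Literature.NumberTheory.Automorphic.isCompact_glFiniteIntegralLevel 2 M) (π : Literature.NumberTheory.Automorphic.CuspidalAutomorphicRepData 2 M hM), Literature.NumberTheory.Automorphic.IsPiOfArtinRep τ π.1) → ∃ (hM : Literature.NumberTheory.Automorphic.isCompact_glFiniteIntegralLevel 2 M) (π : Literature.NumberTheory.Automorphic.CuspidalAutomorphicRepData 2 M hM), Literature.NumberTheory.Automorphic.IsPiOfArtinRep σ' π.1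

/-- item stmt-Langlands-3483 · support · rank 9 · closed · moot by None · by planner
sources: SerreLinearRepresentations1977, §16.4, CurtisReiner1962, §86, ACCGHLNSTT2023, Def 6.2.28 (enormous), AllenKhareThorne2021WeightOne, §9 (H^1(SL_2(F_5), ad^0) != 0)
[support] DEFECT-ZERO ENORMOUSNESS INPUT (card C3). Every 3-dimensional irreducible representation V
of A_5 over a field k of characteristic 3 has H^1(A_5, V) = H^2(A_5, V) = 0. Reason: V is absolutely
irreducible (A_5 perfect, 3 odd) and is a reduction of one of the two ordinary degree-3 characters,
which lie in 3-blocks of DEFECT ZERO (3 || 60 and 3 | 3), hence V is a projective k[A_5]-module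
(Brauer-Nesbitt) and all positive cohomology vanishes. Use in ArtinWeightOrdinaryLifting: for
tau-bar with projective image A_5 in PGL_2(F_9) (p = 3), ad^0 tau-bar is such a V and
inflation-restriction through the centre of 2.A_5 (order 2) gives H^1(2.A_5, ad^0) = 0, so
tau-bar(G_{M(zeta_3)}) is ENORMOUS (ACC+ Def 6.2.28: no 3-power quotient, H^0 = H^1 = 0, order-5
regular semisimple elements fix a line of ad^0); p = 3 is the unique Klein prime with this property
(p = 5: H^1(SL_2(F_5), Sym^2) != 0, AKT §9; p = 2: characteristic-2 pathologies). Provable now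
(finite computation or block theory; Mathlib `Rep`, `groupCohomology.H1/H2`,
`Representation.IsIrreducible`). Sources: SerreLinearRepresentations1977 §16.4 (defect zero);
CurtisReiner1962 §86; ACCGHLNSTT2023 Def 6.2.28; KhareThorne2017 Def -/
@[route_item "route-Langlands-EvenIcosahedralCM"]
def DefectZeroA5 : Prop :=
  ∀ (k : Type) [Field k] [CharP k 3] (V : Rep k (alternatingGroup (Fin 5))), Module.finrank k V = 3 → V.ρ.IsIrreducible → Subsingleton (groupCohomology.H1 V) ∧ Subsingleton (groupCohomology.H2 V)

/-- item stmt-Langlands-3484 · assembly · rank 1 · closed · moot by None · by planner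
sources: Sketch.lean (planner folder), theorem assembly_holds
[assembly] CMOrdinaryDoor -> ArtinWeightOrdinaryLifting -> UntwistAutomorphy ->
SolubleDescentMatching -> EvenIcosahedralStrongArtin. Pure logic, CHECKED: theorem `assembly_holds :
Assembly` in the planner's Sketch.lean (lean check rc 0): the door yields (M, chi, tau) with the
lifting hypotheses verbatim; lifting yields automorphy of tau|_{M'} over a soluble Galois CM M';
restricting the pointwise twist identity is definitional (`restrictField_apply`) and
UntwistAutomorphy gives automorphy of (sigma|_M)|_{M'}; SolubleDescentMatching gives X. A prover may
close this item at once with that 6-line proof. -/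
@[route_item "route-Langlands-EvenIcosahedralCM"]
def Assembly : Prop :=
  CMOrdinaryDoor → ArtinWeightOrdinaryLifting → UntwistAutomorphy → SolubleDescentMatching → EvenIcosahedralStrongArtin

end Summit.Langlands.Langlands.Theses.EvenIcosahedralCM
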